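import Summits.BirchSwinnertonDyer.Rank1Residual.X1.RankOne
import Literature.NumberTheory.EllipticCurves.Wuthrich2014.RankOneEngineProofs
import Literature.NumberTheory.EllipticCurves.PAdicBSD
import Literature.NumberTheory.EllipticCurves.PadicSigmaOddPrime
import HarnessLib

/-!
# Residual class X1 ∩ {r = 1}: the rank-one certificate IS the order-of-vanishing clause of the
# Mazur–Tate–Teitelbaum `p`-adic BSD conjecture on the leaf

HONEST FRAMING (cell `b2b-bsdres`, run/shared/lean/b2b/bsd-rank1-residual/, verbatim in every
file): the goal of the cell is to DELETE the COMBINATION-SHAPED residual classes of the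
Birch–Swinnerton-Dyer formula for ALL analytic-rank `≤ 1` elliptic curves over `ℚ` — "full BSD
formula for every rank `≤ 1` curve in class `C`" assembled STRICTLY from published theorems — so
that the rank-`≤ 1` remainder becomes exactly the CONSTRUCTION-SHAPED classes, which are TYPED
(missing-input `Prop`s), NOT attempted. This is not "finishing BSD". CLASS-OWNERS.md (2026-08-20):
row "X1 (r = 1)" — research route; NO CLAIM BEYOND STATED CLASSES; no label change.

Unit `b2b-bsdres-x1a` (X1 prover A, gen 9). Second sequel of the statement file `X1/RankOne.lean`.
Theorems only; nothing asserted; no fact minted. `X1/RankOne.lean` typed `SchneiderOnLeaf` — the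
non-degeneracy of THE canonical cyclotomic `p`-adic height at every rank-one leaf pair — as "what
`r = 1` needs beyond `r = 0`" on the cyclotomic route (type B needs nothing else: Greenberg–Vatsal;
type A needs it next to Mazur's main conjecture). This file identifies that input with a NAMED
standard conjecture already typed in the tree: clause (i) "`ord_{T=0} L_p(E,T) = rank E(ℚ)`" of the
Mazur–Tate–Teitelbaum `p`-adic BSD conjecture (`Literature.….PAdicBSDConjecture`, bsd.S24;
Invent. Math. 84 (1986) §II.10), at the leaf pair:

* `Leaf.constantCoeff_padicLFunction_eq_zero` — `L_p(E,0) = 0` on the leaf (Mazur–Swinnerton-Dyer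
  interpolation `L_p(f,α,0) = (1-α⁻¹)²·L(E,1)/Ω⁺_f`, a tree theorem, and `L(E,1) = 0`); hence
  `Leaf.order_eq_one_iff_coeff_one_ne_zero` (`ord_{T=0} L_p = 1 ⟺ [T¹]L_p ≠ 0`, pure power-series
  algebra) and, with Perrin-Riou's `p`-adic Gross–Zagier theorem at odd `p` (`hPR`, PUBLISHED) and
  Gross–Zagier–Kolyvagin (`hGZK`), **`Leaf.order_eq_rank_iff_schneider`: at a leaf pair, MTT's
  clause (i) `ord_{T=0} L_p(E,T) = rank E(ℚ)` ⟺ Schneider's non-degeneracy of the canonical height**;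
* `Leaf.schneider_of_padicBSDConjecture` / `schneiderOnLeaf_of_padicBSDConjecture` — the `p`-adic BSD
  conjecture (for the canonical height) on the leaf IMPLIES `SchneiderOnLeaf`; and conversely
  `Leaf.padicBSD_order_of_schneider` — Schneider at the pair gives MTT's clause (i) there (the
  canonical datum exists at odd good ordinary `p`: Mazur–Tate `σ`, `hMT`). So, granted the published
  facts, `SchneiderOnLeaf` ⟺ "MTT (i) at every rank-one anomalous Eisenstein pair"
  (`schneiderOnLeaf_iff_forall_padicBSD_order`).

Consequence for the class record (no label change): on B1 (type B, 37 census pairs `N < 2·10⁴`)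
the ONLY non-published input of the cyclotomic route is MTT (i) at the pair — per pair a finite
`p`-adic `L`-series computation (`[T¹]L_p ≠ 0`; values on file for 754/754 census pairs, two engines,
uncertified by the lane), class-wide OPEN: Schneider 1982/85 = Mazur–Stein–Tate 2006 Conj. 1.1;
Burungale–Skinner, Proc. AMS Ser. B 10 (2023) prove it (via `λ(L_p(E)) = 1`) for infinite families of
quadratic twists at Eisenstein primes, all NON-anomalous (their condition `ψ(p) = -ϕ(p)`), and on the
anomalous leaf `λ(L_p(E)) ≥ 3` at every type-B pair (trivial zero of the odd unramified character's
`p`-adic `L`-function), so no Iwasawa-invariant count certifies clause (i) there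
(HOME/b2b-bsdres-x1a/X1-CHAIN.md §17c).

References: [MazurTateTeitelbaum1986Invent] §II.10 Conj. (BSD(p)); [PerrinRiou1987] §1.4 Cor. 1.8;
[Schneider1985] §1, Thm. 2′; [MazurSteinTate2006] Conj. 1.1; [BurungaleSkinner2023] Thms. 2.8, 2.10,
3.1; [SteinWuthrich2013] §3, §9; [Balakrishnan2016] §2.
-/

noncomputable section

open scoped Classical MatrixGroups ModularForm

open CongruenceSubgroup WeierstrassCurve Literature.NumberTheory.EllipticCurves
  Literature.NumberTheory.EllipticCurves.ModularForms
  Literature.NumberTheory.EllipticCurves.Wuthrich2014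
  Literature.NumberTheory.EllipticCurves.Rank1Residual
  Summit.BirchSwinnertonDyer.BirchSwinnertonDyer.Theorems
  Summit.BirchSwinnertonDyer.BirchSwinnertonDyer.Theorems.Rank1ResidualX1Defs

set_option autoImplicit false

namespace Summit.BirchSwinnertonDyer.Rank1Residual.X1.RankOne

variable {W : WeierstrassCurve ℚ} [W.IsElliptic] [W.IsGloballyMinimal] {p : ℕ} [Fact p.Prime]

/-! ### `L_p(E,T)` on the leaf: zero constant term, so order one iff the linear term is non-zero -/

/-- **Gross–Zagier–Kolyvagin on the leaf:** `rank E(ℚ) = 1` (`hGZK`, PUBLISHED named fact). [folklore] -/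
theorem Leaf.mordellWeilRank_eq_one (hGZK : rank_eq_analyticRank_of_analyticRank_le_one)
    (h : Leaf W p) : W.mordellWeilRank = 1 := by
  have h1 := (hGZK W h.2.le).1
  rwa [h.2] at h1

/-- **`L_p(E,0) = 0` at a leaf pair** for every newform `f` of `E`: Mazur–Swinnerton-Dyer
interpolation `L_p(f,α,0) = (1 - α⁻¹)²·[0]⁺_f` (tree theorem `constantCoeff_padicLFunction_unitRoot`)
and `[0]⁺_f · Ω⁺_f = L(E,1) = 0` since `ord_{s=1} L(E,s) = 1` (tree
`Wuthrich2014.constantCoeff_padicLFunction_eq_zero_of_analyticRank_eq_one`).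
[cite: MazurTateTeitelbaum1986Invent, §I.14 (14.3)] -/
theorem Leaf.constantCoeff_padicLFunction_eq_zero (h : Leaf W p) {N : ℕ} [NeZero N]
    (f : CuspForm (Gamma0 N) 2) (hf : IsNewformOf W f) :
    PowerSeries.constantCoeff (padicLFunction f (unitRoot W p : ℚ_[p])) = 0 :=
  constantCoeff_padicLFunction_eq_zero_of_analyticRank_eq_one W p h.isOrdinaryAt h.2 f hf

/-- **On the leaf, `ord_{T=0} L_p(f,α,T) = 1 ⟺ [T¹]L_p(f,α,T) ≠ 0`** (the constant term vanishes;
Mathlib `PowerSeries.order_eq_nat`). [folklore] -/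
theorem Leaf.order_eq_one_iff_coeff_one_ne_zero (h : Leaf W p) {N : ℕ} [NeZero N]
    (f : CuspForm (Gamma0 N) 2) (hf : IsNewformOf W f) :
    (padicLFunction f (unitRoot W p : ℚ_[p])).order = 1 ↔
      PowerSeries.coeff 1 (padicLFunction f (unitRoot W p : ℚ_[p])) ≠ 0 := by
  have h0 := h.constantCoeff_padicLFunction_eq_zero f hf
  rw [show (1 : ℕ∞) = ((1 : ℕ) : ℕ∞) from rfl, PowerSeries.order_eq_nat]
  constructor
  · exact fun hh ↦ hh.1
  · intro hh
    refine ⟨hh, fun i hi ↦ ?_⟩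
    obtain rfl : i = 0 := by omega
    rwa [PowerSeries.coeff_zero_eq_constantCoeff_apply]

/-! ### MTT's clause (i) at a leaf pair ⟺ Schneider's non-degeneracy -/

/-- **`ord_{T=0} L_p = 1` ⟺ Schneider, at a leaf pair** (canonical datum `Dh`, any newform `f` of
`E`): by `Leaf.order_eq_one_iff_coeff_one_ne_zero` and the certificate converter
`Leaf.coeff_one_ne_zero_iff_schneider` (Perrin-Riou 1987 at odd `p`, `hPR`; GZK, `hGZK`).
[cite: PerrinRiou1987, §1.4 Cor. 1.8] [cite: SteinWuthrich2013, §§3–4, §9] -/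
theorem Leaf.order_eq_one_iff_schneider (hPR : perrinRiou_rankOne_leadingTerms_odd)
    (hGZK : rank_eq_analyticRank_of_analyticRank_le_one) (h : Leaf W p)
    (Dh : PAdicHeightData W p) (hDh : Dh.IsCanonical) {N : ℕ} [NeZero N]
    (f : CuspForm (Gamma0 N) 2) (hf : IsNewformOf W f) :
    (padicLFunction f (unitRoot W p : ℚ_[p])).order = 1 ↔ SchneiderConjecture Dh :=
  (h.order_eq_one_iff_coeff_one_ne_zero f hf).trans (h.coeff_one_ne_zero_iff_schneider hPR hGZK Dh hDh f hf)

/-- **MTT's clause (i) `ord_{T=0} L_p(E,T) = rank E(ℚ)` at a leaf pair ⟺ Schneider's non-degeneracy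
of the canonical height** (Perrin-Riou 1987 `hPR`, GZK `hGZK`; rank `= 1` on the leaf). This is the
precise sense in which the rank-one certificate of class X1 is an instance of the `p`-adic
Birch–Swinnerton-Dyer conjecture (Mazur–Tate–Teitelbaum 1986 §II.10, tree `PAdicBSDConjecture`,
clause (i)). [cite: MazurTateTeitelbaum1986Invent, §II.10 Conj. (BSD(p)) (i)]
[cite: PerrinRiou1987, §1.4 Cor. 1.8] -/
theorem Leaf.order_eq_rank_iff_schneider (hPR : perrinRiou_rankOne_leadingTerms_odd)
    (hGZK : rank_eq_analyticRank_of_analyticRank_le_one) (h : Leaf W p)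
    (Dh : PAdicHeightData W p) (hDh : Dh.IsCanonical) {N : ℕ} [NeZero N]
    (f : CuspForm (Gamma0 N) 2) (hf : IsNewformOf W f) :
    (padicLFunction f (unitRoot W p : ℚ_[p])).order = W.mordellWeilRank ↔ SchneiderConjecture Dh := by
  rw [h.mordellWeilRank_eq_one hGZK, Nat.cast_one]
  exact h.order_eq_one_iff_schneider hPR hGZK Dh hDh f hf

/-- **The `p`-adic BSD conjecture at a leaf pair IMPLIES Schneider there.** If MTT's conjecture
`PAdicBSDConjecture W p D₀` holds for SOME height datum `D₀` (only its datum-independent clause (i)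
`ord_{T=0} L_p = rank` is used), then THE canonical cyclotomic `p`-adic height at `(E,p)` is
non-degenerate (Perrin-Riou 1987 `hPR`, GZK `hGZK`, modularity `hmodP` for a newform of `E`).
[cite: MazurTateTeitelbaum1986Invent, §II.10 Conj. (BSD(p)) (i)] [cite: PerrinRiou1987, §1.4 Cor. 1.8] -/
theorem Leaf.schneider_of_padicBSDConjecture (hPR : perrinRiou_rankOne_leadingTerms_odd)
    (hGZK : rank_eq_analyticRank_of_analyticRank_le_one) (hmodP : nonempty_modularParametrizationData)
    (h : Leaf W p) {D₀ : PAdicHeightData W p} (hMTT : PAdicBSDConjecture W p D₀) :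
    ∀ Dh : PAdicHeightData W p, Dh.IsCanonical → SchneiderConjecture Dh := by
  haveI : NeZero (W.conductorNorm ℤ) := ⟨(W.conductorNorm_pos_holds).ne'⟩
  obtain ⟨Dm⟩ := hmodP W
  have hf : IsNewformOf W Dm.f := Dm.isNewformOf
  have hord := (hMTT h.isOrdinaryAt Dm.f hf).1
  intro Dh hDh
  exact (h.order_eq_rank_iff_schneider hPR hGZK Dh hDh Dm.f hf).mp hord

/-- **Conversely, Schneider at a leaf pair gives MTT's clause (i) there** for every newform of `E`
(the canonical datum exists at an odd good ordinary prime: Mazur–Tate `σ`, `hMT`; Perrin-Riou `hPR`;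
GZK `hGZK`). [cite: MazurTateTeitelbaum1986Invent, §II.10 Conj. (BSD(p)) (i)]
[cite: PerrinRiou1987, §1.4 Cor. 1.8] [cite: Balakrishnan2016, §2 eq. (2.3)] -/
theorem Leaf.padicBSD_order_of_schneider (hPR : perrinRiou_rankOne_leadingTerms_odd)
    (hGZK : rank_eq_analyticRank_of_analyticRank_le_one) (hMT : mazur_tate_sigma_exists_odd)
    (h : Leaf W p) (hSch : ∀ Dh : PAdicHeightData W p, Dh.IsCanonical → SchneiderConjecture Dh)
    {N : ℕ} [NeZero N] (f : CuspForm (Gamma0 N) 2) (hf : IsNewformOf W f) :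
    (padicLFunction f (unitRoot W p : ℚ_[p])).order = W.mordellWeilRank := by
  obtain ⟨Dh, hDh, -⟩ := existsUnique_isCanonical_of_odd hMT W p h.two_ne h.isOrdinaryAt.1
    h.isOrdinaryAt.2
  exact (h.order_eq_rank_iff_schneider hPR hGZK Dh hDh f hf).mpr (hSch Dh hDh)

/-! ### Class level: `SchneiderOnLeaf` ⟺ MTT (i) on the leaf -/

/-- **The `p`-adic BSD conjecture (for the canonical height) on the rank-one leaf IMPLIES
`SchneiderOnLeaf`** — granted Perrin-Riou 1987 (`hPR`), GZK (`hGZK`), modularity (`hmodP`). So the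
rank-one residue of the cyclotomic route sits inside a named standard conjecture (MTT 1986).
[cite: MazurTateTeitelbaum1986Invent, §II.10 Conj. (BSD(p))] [cite: PerrinRiou1987, §1.4 Cor. 1.8] -/
theorem schneiderOnLeaf_of_padicBSDConjecture (hPR : perrinRiou_rankOne_leadingTerms_odd)
    (hGZK : rank_eq_analyticRank_of_analyticRank_le_one) (hmodP : nonempty_modularParametrizationData)
    (hMTT : ∀ (W : WeierstrassCurve ℚ) [W.IsElliptic] [W.IsGloballyMinimal] (p : ℕ) [Fact p.Prime],
      Leaf W p → ∀ Dh : PAdicHeightData W p, Dh.IsCanonical → PAdicBSDConjecture W p Dh) :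
    SchneiderOnLeaf := by
  intro W _ _ p _ hL Dh hDh
  exact hL.schneider_of_padicBSDConjecture hPR hGZK hmodP (hMTT W p hL Dh hDh) Dh hDh

/-- **`SchneiderOnLeaf` ⟺ MTT's clause (i) at every leaf pair (every newform)**, granted the PUBLISHED
facts Perrin-Riou 1987 (`hPR`), GZK (`hGZK`), Mazur–Tate `σ` (`hMT`), modularity (`hmodP`): the
rank-one certificate of class X1, class-wide, is EXACTLY "`ord_{T=0} L_p(E,T) = rank E(ℚ)` at every
rank-one anomalous Eisenstein pair". [cite: MazurTateTeitelbaum1986Invent, §II.10 Conj. (BSD(p)) (i)]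
[cite: PerrinRiou1987, §1.4 Cor. 1.8] [cite: MazurSteinTate2006, Conj. 1.1 (p. 4)] -/
theorem schneiderOnLeaf_iff_forall_padicBSD_order (hPR : perrinRiou_rankOne_leadingTerms_odd)
    (hGZK : rank_eq_analyticRank_of_analyticRank_le_one) (hMT : mazur_tate_sigma_exists_odd)
    (hmodP : nonempty_modularParametrizationData) :
    SchneiderOnLeaf ↔
    ∀ (W : WeierstrassCurve ℚ) [W.IsElliptic] [W.IsGloballyMinimal] (p : ℕ) [Fact p.Prime],
      Leaf W p → ∀ ⦃N : ℕ⦄ [NeZero N] (f : CuspForm (Gamma0 N) 2), IsNewformOf W f →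
        (padicLFunction f (unitRoot W p : ℚ_[p])).order = W.mordellWeilRank := by
  constructor
  · intro hS W _ _ p _ hL N _ f hf
    exact hL.padicBSD_order_of_schneider hPR hGZK hMT (hS W p hL) f hf
  · intro hO W _ _ p _ hL Dh hDh
    haveI : NeZero (W.conductorNorm ℤ) := ⟨(W.conductorNorm_pos_holds).ne'⟩
    obtain ⟨Dm⟩ := hmodP W
    have hf : IsNewformOf W Dm.f := Dm.isNewformOf
    exact (hL.order_eq_rank_iff_schneider hPR hGZK Dh hDh Dm.f hf).mp (hO W p hL Dm.f hf)

/-- **B1 from the published record modulo MTT (i) at the pair** (restatement of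
`Leaf.bsdp_of_gvPar_of_schneider` with the certificate in MTT's currency): at a type-B leaf pair,
`PAdicBSDConjecture W p D₀` for some datum (clause (i) only) + Greenberg–Vatsal, Perrin-Riou–Schneider,
Perrin-Riou 1987, Mazur–Tate `σ`, modularity, GZK ⇒ `BSD(E,p)`.
[cite: GreenbergVatsal2000, Thm. (1.3)] [cite: MazurTateTeitelbaum1986Invent, §II.10 Conj. (BSD(p)) (i)]
[cite: BurungaleSkinner2023, Thm. 3.1 (the printed form of this route, non-anomalous twists)] -/
theorem Leaf.bsdp_of_gvPar_of_padicBSDConjecture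
    (hGV : GreenbergVatsal2000.thm13_charIdeal_eq_of_gvPar)
    (hS : Schneider1985_order_charGenerator_odd) (hPR : perrinRiou_rankOne_leadingTerms_odd)
    (hMT : mazur_tate_sigma_exists_odd) (hmodP : nonempty_modularParametrizationData)
    (hGZK : rank_eq_analyticRank_of_analyticRank_le_one) (h : Leaf W p) (hB : GVPar W p)
    {D₀ : PAdicHeightData W p} (hMTT : PAdicBSDConjecture W p D₀) : BSDp W p :=
  h.bsdp_of_gvPar_of_schneider hGV hS hPR hMT hmodP hGZK hB
    (h.schneider_of_padicBSDConjecture hPR hGZK hmodP hMTT)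

end Summit.BirchSwinnertonDyer.Rank1Residual.X1.RankOne

end
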